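import Summits.ResolutionOfSingularities.ResolutionOfSingularities.Theorems.HilbertSamuelEliminationSigmaMaxModificationsCorridor3WLadderStrataNearFibre
import Summits.ResolutionOfSingularities.ResolutionOfSingularities.Theorems.HilbertSamuelEliminationSigmaMaxModificationsCorridor3WLadderMovingTwoBlownUpCentre
import HarnessLib

/-!
# [OURS · L1 W4.2] The STRATA-half of the MOVING W-ladder, β-twin of layers 6–7: rows (b-curve) and (b-fib) CLOSED FOR EVERY
# ORIGIN (regime-free `Q`) from the (F1♯) binders of 2.14♯ — `Theorem314_geomDir` (stub-3, p507952) and its near-fibre twin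
# `Theorem314_nearFibre_geomDir` (this file) — since (F1♯) is AUTOMATIC at `ē ≤ 2`

Crux chain w42 (`SigmaMaxModifications`, stmt-ResolutionOfSingularities-18506; skeleton `w_ladder` v6 on
`SigmaMaxModificationsCorridor3`, stmt-ResolutionOfSingularities-19249), row «stub-4 → β-twin `WlowStrataM 2` of the strata kernels»
(CHAIN v3.11 RULING (1): `hS` of stub-3's `wlow3TwoM_of_residue`), seat res-L1-w42-stub-4 (gen 4); companion of p510273 (rows (b-fib),
(b-curve)), p511345 ((b-curve) from CJS Thm. 3.14 in the (F1) regime), p515327 ((b-fib) from the near-fibre rendering p514197 in the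
(F1) regime). OURS (cell res-hironaka, slot W4.2); NOT statements of H. Hironaka's manuscript [Hironaka2017] nor of
[CossartJannsenSaito2020]; AI-drafted, weaker than expert review. Every `theorem` is PROVED; the one `def … : Prop` is an OURS
BINDER (conjecture-class carrier, not a statement of any source): `Theorem314_nearFibre_geomDir`, the near-fibre rendering of the
crux chain's «2.14♯» (RULING v3.8-D (D-1): «`x′` near `x` under a permissible blow-up with centre `D ∋ x` ⇒
`x′ ∈ ℙ(Dir_x(X)/T_x(D))` whenever `char k(x) = 0` or `ē_x(X) − dim_x D ≤ 2·char k(x) − 2`») exactly as stub-3's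
`Theorem314_geomDir` (p507952) is the numerical rendering: the printed CJS Thm. 3.14 near-fibre rendering
`Thm314_nearFibre_subsingleton` (p514197) with `CharHypothesis X x` REPLACED by `GeomDirHypothesis X x`
(«`char k(x) = 0 ∨ ē_x(X) + 2 ≤ 2·char k(x)`»). Helper file `--supports stmt-ResolutionOfSingularities-19249`.

## What is proved

* §1 `thm314_nearFibre_subsingleton_of_geomDir : Theorem314_nearFibre_geomDir → Thm314_nearFibre_subsingleton` ((F1) ⇒ (F1♯),
  stub-3's `geomDirHypothesis_of_charHypothesis`): the binder is a STRENGTHENING of the printed fact; its characteristic-`0` /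
  large-characteristic part IS the printed fact, its small-characteristic part is the curve-centre clause of 2.14♯ (res-type-001's
  T7b «(314-cv)», [H4] Thm. IV with normal flatness; OPEN in the tree).
* §2 `StepProjection.nearFibre_subsingleton_geomDir` — §2 of p515327 with `CharHypothesis` ↦ `GeomDirHypothesis`.
* §3 `strataCentreCurveAt_of_theorem314_geomDir : Theorem314_geomDir → ∀ p Q, StrataCentreCurveAt p 3 (QNe Q) (ē ≤ 2)` and
  `strataNearFibreSubsingleton_of_theorem314_nearFibre_geomDir : Theorem314_nearFibre_geomDir → ∀ p Q,
  StrataNearFibreSubsingleton p 3 (QNe Q) (ē ≤ 2)` — **rows (b-curve) and (b-fib) CLOSED FOR EVERY ORIGIN PREDICATE `Q`**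
  (no regime hypothesis: (F1♯) holds at every point with `ē ≤ 2`, stub-3's `geomDirHypothesis_of_geomDirDim_le_two`; the proofs
  are those of p511345 / p515327 verbatim otherwise).
* §4 the regime-free strata row: `wlowStrataM_of_geomDir_centreIO_cycleStartRegular : Theorem314_geomDir →
  Theorem314_nearFibre_geomDir → (c-geo)⊤ → (c-reg)⊤ → WlowStrataM p` (stub-3's socket `hS : WlowStrataM 2` of
  `wlow3TwoM_of_residue`, p508505), the `Q`-generic form, and exactness.

References: CJS LNM 2270 Thm. 3.14, Def. 3.13 (1), Rem. 6.29 (1) [CossartJannsenSaito2020]; H. Hironaka, Ann. of Math. 92 (1970)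
Thm. IV [Hironaka1970]; tree p507952 (`…MovingTwoDefs`: `GeomDirHypothesis`, `Theorem314_geomDir`), p509064 (`Directrix214Sharp`,
the point-centre clause PROVED from [H4] facts), `…MovingTwoBlownUpCentre` (`centreDim_lt_dirDim_of_isBlownUp_geomDir`),
`…MovingTwo` (`geomDirHypothesis_of_geomDirDim_le_two`, `geomDirHypothesis_of_charHypothesis`), this seat's p510273/p511345/p515327.
-/

noncomputable section

-- plan-1/idea-2 module setting kept (namespace `…Corridor3.Moving` re-enters `…Corridor3`)
set_option linter.dupNamespace false

open CategoryTheory AlgebraicGeometry TopologicalSpace Topology IsLocalRing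
open Summit.ResolutionOfSingularities.ResolutionOfSingularities.Theorems.CampaignW42
open Literature.AlgebraicGeometry.Resolution Literature.RingTheory.HilbertSamuel
open Literature.AlgebraicGeometry.CossartJannsenSaito2020
open Summit.ResolutionOfSingularities.ResolutionOfSingularities.Theorems.SigmaMaxModificationsCorridor3

universe u

namespace Summit.ResolutionOfSingularities.ResolutionOfSingularities.Theorems.SigmaMaxModificationsCorridor3.Moving

variable {R : ∀ S : Scheme.{u}, CentreSeq S → Prop} {N : ℕ} {ν : ℕ → ℕ}

/-! ## §1. The (F1♯) binder of the near-fibre rendering -/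

/-- [OURS · L1 W4.2] **BINDER «2.14♯, near-fibre rendering»** — replaces the role of CJS Thm. 3.14 (near-fibre rendering,
`Thm314_nearFibre_subsingleton`, p514197) for the characteristic-`2` threefold row: the same statement with the printed
characteristic hypothesis `CharHypothesis X x` («`char k(x) = 0 ∨ char k(x) ≥ dim X/2 + 1`») REPLACED by (F1♯)
`GeomDirHypothesis X x` («`char k(x) = 0 ∨ ē_x(X) + 2 ≤ 2·char k(x)`», stub-3 p507952) — the crux chain's «2.14♯» (RULING v3.8-D
(D-1)) read on the near fibre: for `X` locally noetherian and excellent, `D = V(I)` permissible, `π` a blow-up in `D`, `N ≥ dim X`,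
`x ∈ V(I)` with `GeomDirHypothesis X x` and `e_x(X) ≤ dim(𝒪_{X,x}/I_x) + 1`, the points of `π⁻¹(x)` near to `x` form a subsingleton.
A STRENGTHENING of the printed fact (`thm314_nearFibre_subsingleton_of_geomDir`); its small-characteristic content is the
curve-centre clause of [H4] Thm. IV / 2.14♯, OPEN in the tree. OURS node (conjecture-class carrier, like stub-3's
`Theorem314_geomDir`); NOT a statement of LNM 2270 nor of the manuscript; not a citation of print; not asserted. -/
def Theorem314_nearFibre_geomDir : Prop :=
  ∀ (X X' : Scheme.{u}) [IsLocallyNoetherian X] (π : X' ⟶ X) (D : X.IdealSheafData),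
    Scheme.IsExcellent X → IdealSheafData.IsPermissible D → IsBlowup π D →
      ∀ N : ℕ, topologicalKrullDim X ≤ (N : WithBot ℕ∞) →
        ∀ x : X, x ∈ D.support → GeomDirHypothesis X x →
          (Scheme.dirDim X x : WithBot ℕ∞) ≤ ringKrullDim (X.presheaf.stalk x ⧸ stalkIdeal D x) + 1 →
            {x' : X' | π.base x' = x ∧ Scheme.hsFun X' N x' = Scheme.hsFun X N x}.Subsingleton

/-- **(F1) ⇒ (F1♯): the binder implies the printed near-fibre rendering** (`Thm314_nearFibre_subsingleton`, p514197).
[cite: CossartJannsenSaito2020, Thm. 3.14, Def. 2.21] -/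
theorem thm314_nearFibre_subsingleton_of_geomDir (h : Theorem314_nearFibre_geomDir.{u}) :
    Thm314_nearFibre_subsingleton.{u} := by
  intro X X' _ π D hX hD hπ N hN x hxD hchar he
  exact h X X' π D hX hD hπ N hN x hxD (geomDirHypothesis_of_charHypothesis hchar) he

/-! ## §2. The binder read on a step projection -/

/-- **The points of `X_{n+1}(ν)` over `x_n` form a subsingleton, (F1♯) form**: §2 of p515327
(`StepProjection.nearFibre_subsingleton`) with `CharHypothesis` replaced by `GeomDirHypothesis`.
[cite: CossartJannsenSaito2020, Thm. 3.14, Def. 3.13 (1)] -/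
theorem StepProjection.nearFibre_subsingleton_geomDir (hFf : Theorem314_nearFibre_geomDir.{u}) (hRf : OracleFunctional R)
    {s s' : MarkedStage.{u}} {f : s'.W ⟶ s.W} (hf : StepProjection R N ν s s' f) {C : s.W.IdealSheafData}
    {P' : Option (Pending (blowup C))} (hcs : IsCanonicalStep R N ν s.L s.P C P') (hexc : Scheme.IsExcellent s.W)
    (hperm : IdealSheafData.IsPermissible C) (hdim : topologicalKrullDim s.W ≤ (N : WithBot ℕ∞))
    (hmem : s.pt ∈ (C.support : Set s.W)) (hgeo : @GeomDirHypothesis s.W s.ln s.pt) (hpt : s.pt ∈ Scheme.hsStratum s.W N ν)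
    (he : (@Scheme.dirDim s.W s.ln s.pt : WithBot ℕ∞) ≤ ringKrullDim (s.W.presheaf.stalk s.pt ⧸ stalkIdeal C s.pt) + 1) :
    {z : s'.W | f.base z = s.pt ∧ z ∈ Scheme.hsStratum s'.W N ν}.Subsingleton := by
  haveI := s.ln
  obtain ⟨C₂, P₂, hln, x', hcs₂, hπ, hcl, hx', e, rfl⟩ := hf
  obtain rfl : C₂ = C := hcs₂.centre_unique hRf hcs
  subst e
  simp only [eqToHom_refl, Category.id_comp]
  have key := hFf s.W (blowup C₂) (blowup.π C₂) C₂ hexc hperm (blowup.isBlowup C₂) N hdim s.pt hmem hgeo he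
  refine key.anti fun z hz => ⟨hz.1, ?_⟩
  rw [Scheme.mem_hsStratum_iff.mp hz.2, Scheme.mem_hsStratum_iff.mp hpt]

/-! ## §3. Rows (b-curve) and (b-fib) for every origin predicate -/

/-- **ROW (b-curve) FOR EVERY ORIGIN PREDICATE `Q`** (modulo the (F1♯) binder `Theorem314_geomDir`, stub-3 p507952): along every
chain from a maximal origin with `ν ≠ Φ^{(3)}` and `ē ≤ 2`, at every blown-up step every irreducible closed subset of the centre's
support through the chain point is `{x_n}` or an irreducible component of the support — the proof of p511345 with (F1♯), which is
automatic at `ē ≤ 2`, in place of (F1). [cite: CossartJannsenSaito2020, Thm. 3.14, Def. 3.1, Rem. 6.29 (1)] -/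
theorem strataCentreCurveAt_of_theorem314_geomDir (hF : Theorem314_geomDir.{u}) (p : ℕ)
    (Q : ℕ → (ℕ → ℕ) → ∀ X : Scheme.{u}, X → Prop) :
    StrataCentreCurveAt.{u} p 3 (QNe Q) fun s => s.geomDirDim ≤ 2 := by
  intro R hRf hRa ν X _ x hX hQ c h0 hstep hG _ _
  refine ⟨0, fun n _ hbu _ C P' hcs A hAC hAirr hAcl hxA => ?_⟩
  obtain ⟨-, hν⟩ := hQ
  obtain ⟨k, _, _, f, -, hft, hqc⟩ := hX.exists_structure
  haveI := hft
  haveI := hqc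
  haveI := hX.isReduced
  have hgood : StateGood k R 3 ν (c n).W (c n).L (c n).P :=
    stateGood_of_reaches (stateGood_init_general hRa f hX.dim_le hX.maximal hν) (reaches_chain h0 hstep n)
  haveI : IsLocallyNoetherian (c n).W := (c n).ln
  haveI : IsNoetherian (c n).W := hgood.isNoetherian
  have hpt : (c n).pt ∈ Scheme.hsStratum (c n).W 3 ν := pt_mem_hsStratum_of_reaches hX.mem_stratum (reaches_chain h0 hstep n)
  have hptcl : IsClosed ({(c n).pt} : Set (c n).W) := Reaches.isClosed_pt hX.isClosed (reaches_chain h0 hstep n)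
  obtain ⟨C₁, P₁, hcs₁, hmem⟩ := hbu
  obtain rfl : C₁ = C := hcs₁.centre_unique hRf hcs
  -- 2.14♯ numerical: `dim 𝒪_{C,x_n} < e_{x_n} ≤ ē_{x_n} ≤ 2`
  have key := centreDim_lt_dirDim_of_isBlownUp_geomDir hF hRf hgood hpt (hstep n)
    (@geomDirHypothesis_of_geomDirDim_le_two (c n).W (c n).ln (c n).pt (hG n)) hcs₁ hmem
  have he2 : (dirDim (c n) : WithBot ℕ∞) ≤ 2 := by
    have h1 : dirDim (c n) ≤ 2 := (Scheme.dirDim_le_geomDirDim (c n).pt).trans (hG n)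
    exact_mod_cast h1
  have hlt : ringKrullDim ((c n).W.presheaf.stalk (c n).pt ⧸ stalkIdeal C₁ (c n).pt) < 2 := key.trans_le he2
  -- topology: `A` between `{x_n}` and a component of `V(C)`
  refine or_iff_not_imp_left.mpr fun hne => ?_
  by_contra hnot
  obtain ⟨D₀, hD₀, hAD⟩ := exists_componentsIn_superset C₁.support.isClosed (componentsIn.finite _) hAirr hAC
  have hAD' : A ≠ D₀ := fun h => hnot (h ▸ hD₀)
  have hD₀irr : IsIrreducible D₀ := componentsIn.isIrreducible hD₀
  have hD₀cl : IsClosed D₀ := componentsIn.isClosed C₁.support.isClosed hD₀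
  have hAgen : IsGenericPoint hAirr.genericPoint A := hAirr.isGenericPoint_genericPoint hAcl
  have hDgen : IsGenericPoint hD₀irr.genericPoint D₀ := hD₀irr.isGenericPoint_genericPoint hD₀cl
  set a := hAirr.genericPoint with hadef
  set η := hD₀irr.genericPoint with hηdef
  have hax : a ⤳ (c n).pt := hAgen.specializes hxA
  have hηa : η ⤳ a := hDgen.specializes (hAD hAgen.mem)
  have hne₁ : a ≠ (c n).pt := by
    intro h
    apply hne
    rw [← hAgen.def, h, hptcl.closure_eq]
  have hne₂ : η ≠ a := by
    intro h
    apply hAD'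
    rw [← hAgen.def, ← hDgen.def, h]
  have hηI : η ∈ C₁.support := (componentsIn.subset hD₀) hDgen.mem
  have haI : a ∈ C₁.support := hAC hAgen.mem
  have h2 := two_le_ringKrullDim_quotient_stalkIdeal C₁ hax hηa hne₁ hne₂ hηI haI
  exact absurd (h2.trans_lt hlt) (lt_irrefl _)

/-- **ROW (b-fib) FOR EVERY ORIGIN PREDICATE `Q`** (modulo the (F1♯) binder `Theorem314_nearFibre_geomDir`): along every never-isolated
chain from a maximal origin with `ν ≠ Φ^{(3)}` and `ē ≤ 2`, at every blown-up cycle-end step the points of `X_{n+1}(ν)` over `x_n`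
form a subsingleton — the proof of p515327 with (F1♯) in place of (F1). [cite: CossartJannsenSaito2020, Thm. 3.14, Rem. 6.29 (1)] -/
theorem strataNearFibreSubsingleton_of_theorem314_nearFibre_geomDir (hFf : Theorem314_nearFibre_geomDir.{u}) (p : ℕ)
    (Q : ℕ → (ℕ → ℕ) → ∀ X : Scheme.{u}, X → Prop) :
    StrataNearFibreSubsingleton.{u} p 3 (QNe Q) fun s => s.geomDirDim ≤ 2 := by
  intro R hRf hRa ν X _ x hX hQ c h0 hstep hG hnI _
  refine ⟨0, fun n _ hbu hnone f hf => ?_⟩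
  obtain ⟨-, hν⟩ := hQ
  obtain ⟨k, _, _, g, -, hft, hqc⟩ := hX.exists_structure
  haveI := hft
  haveI := hqc
  haveI := hX.isReduced
  have hgood : StateGood k R 3 ν (c n).W (c n).L (c n).P :=
    stateGood_of_reaches (stateGood_init_general hRa g hX.dim_le hX.maximal hν) (reaches_chain h0 hstep n)
  obtain ⟨-, k', _, hinv⟩ := exists_cycleInv_chain' hRf hRa hX h0 hstep
  haveI : IsLocallyNoetherian (c n).W := (c n).ln
  haveI : IsNoetherian (c n).W := (hinv n).isNoetherian
  have hpt : (c n).pt ∈ Scheme.hsStratum (c n).W 3 ν := pt_mem_hsStratum_of_reaches hX.mem_stratum (reaches_chain h0 hstep n)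
  have hptcl : IsClosed ({(c n).pt} : Set (c n).W) := Reaches.isClosed_pt hX.isClosed (reaches_chain h0 hstep n)
  obtain ⟨C, P₁, hcs, hmem⟩ := hbu
  have hsupp : (C.support : Set (c n).W) = (c n).L.part (Scheme.hsStratum (c n).W 3 ν) (treatedLabel 3 ν (c n)) :=
    support_eq_part_of_next_none hRf (hstep n) hnone hcs
  obtain ⟨D₀, hD₀, hxD₀⟩ := componentsIn.exists_mem hmem
  have hD₀' : D₀ ∈ componentsIn (Scheme.hsStratum (c n).W 3 ν) := by
    have hD₀p : D₀ ∈ componentsIn ((c n).L.part (Scheme.hsStratum (c n).W 3 ν) (treatedLabel 3 ν (c n))) := hsupp ▸ hD₀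
    exact componentsIn_part_subset (c n).L (hinv n).isClosed_hsStratum (componentsIn.finite _) _ hD₀p
  have hD₀ne : D₀ ≠ {(c n).pt} := fun h =>
    (hinv n).singleton_notMem_componentsIn_of_not_iso hpt (hnI n) (h ▸ hD₀')
  have hD₀irr : IsIrreducible D₀ := componentsIn.isIrreducible hD₀
  have hD₀cl : IsClosed D₀ := componentsIn.isClosed C.support.isClosed hD₀
  have hDgen : IsGenericPoint hD₀irr.genericPoint D₀ := hD₀irr.isGenericPoint_genericPoint hD₀cl
  set η := hD₀irr.genericPoint with hηdef
  have hηx : η ⤳ (c n).pt := hDgen.specializes hxD₀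
  have hηne : η ≠ (c n).pt := by
    intro h
    apply hD₀ne
    rw [← hDgen.def, h, hptcl.closure_eq]
  have hηI : η ∈ C.support := (componentsIn.subset hD₀) hDgen.mem
  have h1 : (1 : WithBot ℕ∞) ≤ ringKrullDim ((c n).W.presheaf.stalk (c n).pt ⧸ stalkIdeal C (c n).pt) :=
    one_le_ringKrullDim_quotient_stalkIdeal C hηx hηne hηI
  have he2 : (Scheme.dirDim (c n).W (c n).pt : WithBot ℕ∞) ≤ 2 := by
    have h1 : Scheme.dirDim (c n).W (c n).pt ≤ 2 := (Scheme.dirDim_le_geomDirDim (c n).pt).trans (hG n)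
    exact_mod_cast h1
  have he : (Scheme.dirDim (c n).W (c n).pt : WithBot ℕ∞) ≤
      ringKrullDim ((c n).W.presheaf.stalk (c n).pt ⧸ stalkIdeal C (c n).pt) + 1 := by
    refine he2.trans ?_
    have h2 : (2 : WithBot ℕ∞) = 1 + 1 := by norm_num
    rw [h2]
    exact add_le_add h1 le_rfl
  exact hf.nearFibre_subsingleton_geomDir hFf hRf hcs hgood.isExcellent (hgood.isPermissible hcs) hgood.dim_le hmem
    (@geomDirHypothesis_of_geomDirDim_le_two (c n).W (c n).ln (c n).pt (hG n)) hpt he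

/-! ## §4. The strata row for every origin, modulo the two (F1♯) binders and the kernels (c-geo), (c-reg) -/

/-- **The strata row at any origin predicate `Q` FROM the two 2.14♯ binders, (c-geo) and (c-reg).**
[cite: CossartJannsenSaito2020, Thm. 3.14, Thm. 6.35, Rem. 6.29 (1)] -/
theorem maxOriginNoMovingNearChainAtQ_notIso_of_geomDir_centreIO_cycleStartRegular {p : ℕ}
    {Q : ℕ → (ℕ → ℕ) → ∀ X : Scheme.{u}, X → Prop} (hF : Theorem314_geomDir.{u}) (hFf : Theorem314_nearFibre_geomDir.{u})
    (hgeo : StrataLineageInCentreIO p 3 (QNe Q) fun s => s.geomDirDim ≤ 2)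
    (hreg : StrataCycleStartRegular p 3 (QNe Q) fun s => s.geomDirDim ≤ 2) :
    MaxOriginNoMovingNearChainAtQ p 3 Q fun s => s.geomDirDim ≤ 2 ∧ ¬ Iso 3 s :=
  maxOriginNoMovingNearChainAtQ_notIso_of_fibre_curve_centreIO_cycleStartRegular
    (strataNearFibreSubsingleton_of_theorem314_nearFibre_geomDir hFf p Q) (strataCentreCurveAt_of_theorem314_geomDir hF p Q)
    hgeo hreg

/-- **`WlowStrataM p` — THE REGIME-FREE STRATA ROW (stub-3's socket `hS` of `wlow3TwoM_of_residue`, p508505) FROM the two 2.14♯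
binders, (c-geo)⊤ and (c-reg)⊤.** [cite: CossartJannsenSaito2020, Thm. 3.14, Thm. 6.35, Rem. 6.29 (1)] -/
theorem wlowStrataM_of_geomDir_centreIO_cycleStartRegular {p : ℕ} (hF : Theorem314_geomDir.{0})
    (hFf : Theorem314_nearFibre_geomDir.{0})
    (hgeo : StrataLineageInCentreIO.{0} p 3 (QNe fun _ _ _ _ => True) fun s => s.geomDirDim ≤ 2)
    (hreg : StrataCycleStartRegular.{0} p 3 (QNe fun _ _ _ _ => True) fun s => s.geomDirDim ≤ 2) : WlowStrataM p :=
  maxOriginNoMovingNearChainAt_of_atQ_true (maxOriginNoMovingNearChainAtQ_notIso_of_geomDir_centreIO_cycleStartRegular hF hFf hgeo hreg)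

/-- … and the (F1)-regime row `Wlow3CharStrataM p` from the same binders (the binders being stronger than the printed facts).
[cite: CossartJannsenSaito2020, Thm. 3.14, Thm. 6.35, Rem. 6.29 (1)] -/
theorem wlow3CharStrataM_of_geomDir_centreIO_cycleStartRegular {p : ℕ} (hF : Theorem314_geomDir.{0})
    (hFf : Theorem314_nearFibre_geomDir.{0})
    (hgeo : StrataLineageInCentreIO.{0} p 3 (QNe (Helpers.QCharRegime p)) fun s => s.geomDirDim ≤ 2)
    (hreg : StrataCycleStartRegular.{0} p 3 (QNe (Helpers.QCharRegime p)) fun s => s.geomDirDim ≤ 2) :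
    Wlow3CharStrataM p :=
  maxOriginNoMovingNearChainAtQ_notIso_of_geomDir_centreIO_cycleStartRegular hF hFf hgeo hreg

/-- Exactness: given the two binders, the strata row at `Q` is EQUIVALENT to (c-geo) ∧ (c-reg) at `QNe Q`. [folklore] -/
theorem maxOriginNoMovingNearChainAtQ_notIso_iff_centreIO_cycleStartRegular_of_geomDir {p : ℕ}
    {Q : ℕ → (ℕ → ℕ) → ∀ X : Scheme.{u}, X → Prop} (hF : Theorem314_geomDir.{u}) (hFf : Theorem314_nearFibre_geomDir.{u}) :
    (MaxOriginNoMovingNearChainAtQ p 3 Q fun s => s.geomDirDim ≤ 2 ∧ ¬ Iso 3 s) ↔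
      (StrataLineageInCentreIO p 3 (QNe Q) fun s => s.geomDirDim ≤ 2) ∧
        StrataCycleStartRegular p 3 (QNe Q) fun s => s.geomDirDim ≤ 2 := by
  refine ⟨fun h => ?_, fun ⟨hgeo, hreg⟩ =>
    maxOriginNoMovingNearChainAtQ_notIso_of_geomDir_centreIO_cycleStartRegular hF hFf hgeo hreg⟩
  have h' := (maxOriginNoMovingNearChainAtQ_notIso_iff_fibre_curve_centreIO_cycleStartRegular
    (p := p) (N := 3) (Q := Q) (G := fun s => s.geomDirDim ≤ 2)).mp h
  exact ⟨h'.2.2.1, h'.2.2.2⟩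

end Summit.ResolutionOfSingularities.ResolutionOfSingularities.Theorems.SigmaMaxModificationsCorridor3.Moving

end
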